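import Literature.NumberTheory.QuadraticForms.LandherrHermitianMatrices
import Literature.NumberTheory.QuadraticForms.HermitianFormDefiniteAnisotropic
import HarnessLib

/-!
# Landherr's isotropy criterion: a hermitian form of rank ≥ 3 over a CM field is isotropic iff it is indefinite at every real place

Topic `NumberTheory/QuadraticForms`; theorems only (no definition, no named fact, no instance).

Let `L` be a CM field with complex conjugation `σ = IsCMField.complexConj L` and maximal real subfield
`L⁺`, and let `⟨a₁, …, aₙ⟩` (`aᵢ ∈ L⁺ˣ`, i.e. `σ aᵢ = aᵢ ≠ 0`) be the diagonal hermitian form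
`v ↦ ∑ aᵢ vᵢ σ(vᵢ)` on `Lⁿ`.  At a complex embedding `τ` of `L` the real numbers `τ(aᵢ)` have
`Landherr.posCount L τ a` positive signs (the index `a_τ` of Deligne, LNM 900 §4 p. 44; `(p_v, q_v)` of
Shimura, Doc. Math. 13 (2008) §2.1).  **Theorem** (`hermitianDiagonal_isotropic_iff_indefinite`): if `n ≥ 3`,

  `∃ v ≠ 0, ∑ aᵢ vᵢ σ(vᵢ) = 0`  `↔`  at every `τ` some `τ(aᵢ) < 0` and some `τ(aⱼ) > 0`

(`↔ ∀ τ, 0 < posCount < n`, `hermitianDiagonal_isotropic_iff_posCount`); and the Gram-matrix form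
`hermitianMatrix_isotropic_iff_indefinite` for a non-degenerate `σ`-hermitian matrix `H` of size `≥ 3` and the
tree's sesquilinear form `hermForm σ H` (`Literature.AlgebraicGeometry.ShimuraVarieties.hermForm`): `H` has an
isotropic vector iff at every `τ` the complex hermitian matrix `τ(H)` has at least one positive and at least one
non-positive (hence negative) eigenvalue.

Proof.  `→`: a form definite at `τ` is anisotropic (`Landherr.not_exists_isotropic_of_posDef_map_complexConj`,
applied to `diag a` or to `diag (-a)`; `Matrix.posDef_diagonal_iff`).  `←` (the arithmetic): Jacobson's trace
form — write `vᵢ = xᵢ + yᵢθ` with `xᵢ, yᵢ ∈ L⁺` and `θ ≠ 0`, `σθ = -θ` (`Landherr.exists_skew`), so that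
`vᵢ σ(vᵢ) = xᵢ² - θ² yᵢ²` and `∑ aᵢ vᵢ σ(vᵢ)` is the diagonal quadratic form
`⟨a₁, …, aₙ, -θ²a₁, …, -θ²aₙ⟩` over the number field `L⁺` in `2n ≥ 6 ≥ 5` variables, indefinite at every real
embedding `ρ` of `L⁺` (extend `ρ` to `τ : L → ℂ`, `Landherr.exists_embedding_extending`; both signs occur among the
`ρ(aᵢ) = Re τ(aᵢ)`).  By the Hasse–Minkowski theorem over `L⁺` in O'Meara's form 66:1 + 63:19 (the tree theorem
`diagIsotropic_of_five_le_of_indefinite`) it has a non-trivial zero `(x, y)`, and `v = x + yθ ≠ 0`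
(`Landherr.eq_zero_of_add_mul_skew`).  The matrix form follows by diagonalising `H` over `L`
(`hermitianMatrix_congruent_diagonal`), transporting isotropic vectors along the change of coordinates
(`Landherr.hermForm_mulVec_mulVec`, `Landherr.mulVec_ne_zero`) and reading the positive index off the eigenvalues
of `τ(H)` (`Landherr.card_pos_eigenvalues_eq_posCount`, Sylvester).

This is the isotropy half of Landherr's theory [La36] as used for arithmetic quotients of complex balls: the
unitary group of `(V, h)`, `dim_L V = n ≥ 3`, is `L⁺`-isotropic iff `h` is indefinite at every real place of
`L⁺` (Deligne, LNM 900 Prop. 4.1/Cor. 4.2 p. 44–45 treat the classification and the split case; Shimura 2008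
§2.1 p. 747 records the local Witt indices).  No statement of [La36] is used as a hypothesis: the only
arithmetic input is the proved tree theorem `diagIsotropic_of_five_le_of_indefinite` [Omeara1963, 66:1, 63:19].

Provenance: `pub-hodgecm` package file `Proofs/LandherrIsotropy.lean` (gen 9–12: rank 3 over an imaginary
quadratic field, via the classification); generalised here to every CM field and every rank `≥ 3` with a direct
Hasse–Minkowski proof, in tree vocabulary.

## References

* W. Landherr, *Äquivalenz Hermitescher Formen über einem beliebigen algebraischen Zahlkörper*, Abh. Math.
  Sem. Univ. Hamburg 11 (1936) 245–248 [Landherr1936HermitianForms].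
* O. T. O'Meara, *Introduction to Quadratic Forms*, Grundlehren 117 (1963), §66 Thm 66:1, Prop. 63:19
  [Omeara1963].
* P. Deligne, *Hodge cycles on abelian varieties*, in LNM 900 (1982), §4 Prop. 4.1, Cor. 4.2, pp. 44–45
  [Deligne1982HodgeCycles].
* G. Shimura, *Arithmetic of hermitian forms*, Doc. Math. 13 (2008) 739–774, §2.1 (doi 10.4171/dm/258).
* W. Scharlau, *Quadratic and Hermitian Forms*, Grundlehren 270 (1985), Ch. 10 §1 (Jacobson's trace form)
  [Scharlau1985HermitianForms].
-/

noncomputable section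

open NumberField
open scoped Matrix ComplexConjugate ComplexOrder
open Literature.AlgebraicGeometry.ShimuraVarieties (hermForm)

namespace Literature.NumberTheory.QuadraticForms

namespace Landherr

variable (L : Type) [Field L] [NumberField L] [IsCMField L]

/-! ## §1. The diagonal hermitian form as a `hermForm`; definite somewhere ⇒ anisotropic -/

section Definite

variable {ι : Type} [Fintype ι] [DecidableEq ι]

omit [NumberField L] [IsCMField L] in
/-- The sesquilinear form with diagonal Gram matrix: `⟪u, v⟫_{diag a} = ∑ aᵢ σ(uᵢ) vᵢ`. [folklore] -/
theorem hermForm_diagonal (σ : L →+* L) (a u v : ι → L) :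
    hermForm σ (Matrix.diagonal a) u v = ∑ i, a i * (σ (u i) * v i) := by
  unfold hermForm dotProduct
  exact Finset.sum_congr rfl fun i _ => by rw [Matrix.mulVec_diagonal, Function.comp_apply]; ring

/-- The hermitian length of `v` for the diagonal Gram matrix `diag a` and `σ = IsCMField.complexConj L` is
`∑ aᵢ vᵢ σ(vᵢ)`. [folklore] -/
theorem hermForm_complexConj_diagonal_self (a v : ι → L) :
    hermForm (IsCMField.complexConj L : L →+* L) (Matrix.diagonal a) v v =
      ∑ i, a i * (v i * IsCMField.complexConj L (v i)) := by
  rw [hermForm_diagonal]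
  exact Finset.sum_congr rfl fun i _ => by rw [RingHom.coe_coe]; ring

omit [Fintype ι] in
/-- A diagonal hermitian form with `σ`-fixed entries all positive at the complex embedding `τ` has positive
definite complex Gram matrix `τ(diag a)`. [folklore] -/
theorem posDef_map_diagonal {a : ι → L} (ha : ∀ i, IsCMField.complexConj L (a i) = a i) (τ : L →+* ℂ)
    (hpos : ∀ i, 0 < (τ (a i)).re) : ((Matrix.diagonal a).map τ).PosDef := by
  rw [Matrix.diagonal_map (map_zero τ), Matrix.posDef_diagonal_iff]
  intro i
  rw [embedding_eq_re (ha i) τ, Complex.zero_lt_real]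
  exact hpos i

/-- **Positive definite at one place ⇒ anisotropic** (diagonal form). [folklore] -/
theorem not_exists_isotropic_of_forall_pos {a : ι → L} (ha : ∀ i, IsCMField.complexConj L (a i) = a i)
    (τ : L →+* ℂ) (hpos : ∀ i, 0 < (τ (a i)).re) :
    ¬ ∃ v : ι → L, v ≠ 0 ∧ ∑ i, a i * (v i * IsCMField.complexConj L (v i)) = 0 := by
  rintro ⟨v, hv, h⟩
  refine not_exists_isotropic_of_posDef_map_complexConj L (Matrix.diagonal a) τ
    (posDef_map_diagonal L ha τ hpos) ⟨v, hv, ?_⟩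
  rw [hermForm_complexConj_diagonal_self]
  exact h

/-- **Negative definite at one place ⇒ anisotropic** (diagonal form; apply the previous lemma to `-a`).
[folklore] -/
theorem not_exists_isotropic_of_forall_neg {a : ι → L} (ha : ∀ i, IsCMField.complexConj L (a i) = a i)
    (τ : L →+* ℂ) (hneg : ∀ i, (τ (a i)).re < 0) :
    ¬ ∃ v : ι → L, v ≠ 0 ∧ ∑ i, a i * (v i * IsCMField.complexConj L (v i)) = 0 := by
  rintro ⟨v, hv, h⟩
  have ha' : ∀ i, IsCMField.complexConj L (-a i) = -a i := fun i => by rw [map_neg, ha i]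
  refine not_exists_isotropic_of_forall_pos L ha' τ (fun i => ?_) ⟨v, hv, ?_⟩
  · rw [map_neg, Complex.neg_re]
    exact neg_pos.mpr (hneg i)
  · simp only [neg_mul, Finset.sum_neg_distrib, h, neg_zero]

omit [DecidableEq ι] in
/-- At a complex embedding, "some entry negative and some entry positive" is `0 < posCount < rank` for a
diagonal form with entries in `L⁺ˣ`. [folklore] -/
theorem exists_neg_pos_iff_posCount {a : ι → L} (ha : ∀ i, IsCMField.complexConj L (a i) = a i)
    (ha0 : ∀ i, a i ≠ 0) (τ : L →+* ℂ) :
    (∃ i j, (τ (a i)).re < 0 ∧ 0 < (τ (a j)).re) ↔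
      0 < posCount L τ a ∧ posCount L τ a < Fintype.card ι := by
  have hne : ∀ i, (τ (a i)).re ≠ 0 := fun i => re_ne_zero_of_isReal (ha i) (ha0 i) τ
  constructor
  · rintro ⟨i, j, hi, hj⟩
    refine ⟨Nat.pos_of_ne_zero fun h => (posCount_eq_zero_iff L τ a).mp h j hj,
      lt_of_le_of_ne (posCount_le_card L τ a) fun h => ?_⟩
    exact (not_lt.mpr ((posCount_eq_card_iff L τ a).mp h i).le) hi
  · rintro ⟨h1, h2⟩
    obtain ⟨j, hj⟩ : ∃ j, 0 < (τ (a j)).re := by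
      by_contra h
      exact (Nat.pos_iff_ne_zero.mp h1) ((posCount_eq_zero_iff L τ a).mpr fun j hj => h ⟨j, hj⟩)
    obtain ⟨i, hi⟩ : ∃ i, ¬ 0 < (τ (a i)).re := by
      by_contra h
      exact h2.ne ((posCount_eq_card_iff L τ a).mpr fun i => not_not.mp fun hi => h ⟨i, hi⟩)
    exact ⟨i, j, lt_of_le_of_ne (not_lt.mp hi) (hne i), hj⟩

omit [DecidableEq ι] in
/-- Isotropy of a diagonal hermitian form is invariant under reindexing. [folklore] -/
theorem exists_isotropic_comp_equiv_iff {κ : Type} [Fintype κ] (e : ι ≃ κ) (a : κ → L) :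
    (∃ v : ι → L, v ≠ 0 ∧ ∑ i, a (e i) * (v i * IsCMField.complexConj L (v i)) = 0) ↔
      ∃ w : κ → L, w ≠ 0 ∧ ∑ k, a k * (w k * IsCMField.complexConj L (w k)) = 0 := by
  constructor
  · rintro ⟨v, hv, h⟩
    refine ⟨v ∘ e.symm, fun h0 => hv (funext fun i => ?_), ?_⟩
    · simpa using congrFun h0 (e i)
    · rw [← h]
      exact (Fintype.sum_equiv e _ _ fun i => by simp).symm
  · rintro ⟨w, hw, h⟩
    refine ⟨w ∘ e, fun h0 => hw (funext fun k => ?_), ?_⟩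
    · simpa using congrFun h0 (e.symm k)
    · rw [← h]
      exact Fintype.sum_equiv e _ _ fun i => rfl

end Definite

/-! ## §2. Indefinite everywhere ⇒ isotropic (Hasse–Minkowski over `L⁺` via Jacobson's trace form) -/

section Indefinite

/-- **Indefinite at every real place ⇒ isotropic**, over `Fin n`, `n ≥ 3`.  Jacobson's trace form
`⟨a, -θ²a⟩` over `L⁺` has `2n ≥ 5` variables and is indefinite at every real embedding of `L⁺`, so it
has a non-trivial zero by the Hasse–Minkowski theorem over the number field `L⁺`
(`diagIsotropic_of_five_le_of_indefinite`, O'Meara 66:1 with 63:19); `v = x + yθ` is then a non-zero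
isotropic vector of `⟨a⟩`. [cite: Landherr1936HermitianForms] -/
theorem exists_isotropic_of_indefinite_fin {n : ℕ} (hn : 3 ≤ n) (a : Fin n → L)
    (ha : ∀ i, IsCMField.complexConj L (a i) = a i) (ha0 : ∀ i, a i ≠ 0)
    (hind : ∀ τ : L →+* ℂ, ∃ i j, (τ (a i)).re < 0 ∧ 0 < (τ (a j)).re) :
    ∃ v : Fin n → L, v ≠ 0 ∧ ∑ i, a i * (v i * IsCMField.complexConj L (v i)) = 0 := by
  obtain ⟨θ, hθ0, hθ⟩ := exists_skew L
  have hθ2 : IsCMField.complexConj L (θ ^ 2) = θ ^ 2 := by rw [map_pow, hθ, neg_sq]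
  have hfix : ∀ y : maximalRealSubfield L, IsCMField.complexConj L y = y :=
    IsCMField.complexConj_apply_eq_self L
  -- the coefficients of Jacobson's form over `F = L⁺`
  let A : Fin n → maximalRealSubfield L :=
    fun i => ⟨a i, (IsCMField.complexConj_eq_self_iff L _).mp (ha i)⟩
  let D : maximalRealSubfield L := ⟨θ ^ 2, (IsCMField.complexConj_eq_self_iff L _).mp hθ2⟩
  let c : Fin (n + n) → maximalRealSubfield L := Fin.append A (fun i => -(D * A i))
  have hA0 : ∀ i, A i ≠ 0 := fun i h => ha0 i (by simpa [A] using congrArg Subtype.val h)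
  have hD0 : D ≠ 0 := fun h => pow_ne_zero 2 hθ0 (by simpa [D] using congrArg Subtype.val h)
  have hcl : ∀ i, c (Fin.castAdd n i) = A i := fun i => Fin.append_left A _ i
  have hcr : ∀ i, c (Fin.natAdd n i) = -(D * A i) := fun i => Fin.append_right A _ i
  have hc0 : ∀ i, c i ≠ 0 := by
    intro i
    induction i using Fin.addCases with
    | left i => rw [hcl]; exact hA0 i
    | right i => rw [hcr]; exact neg_ne_zero.mpr (mul_ne_zero hD0 (hA0 i))
  -- indefinite at every real embedding of `L⁺`: both signs already occur among the `aᵢ`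
  have hsgn : ∀ ρ : maximalRealSubfield L →+* ℝ, ∃ i j, ρ (c i) < 0 ∧ 0 < ρ (c j) := by
    intro ρ
    obtain ⟨τ, hτ⟩ := exists_embedding_extending L ρ
    have hre : ∀ i, (τ (a i)).re = ρ (A i) := fun i => by
      rw [show a i = ((A i : maximalRealSubfield L) : L) from rfl, hτ]; simp
    obtain ⟨i, j, hi, hj⟩ := hind τ
    exact ⟨Fin.castAdd n i, Fin.castAdd n j, by rw [hcl, ← hre]; exact hi, by rw [hcl, ← hre]; exact hj⟩
  -- a non-trivial zero over `L⁺` (Hasse–Minkowski, O'Meara 66:1 with 63:19; `2n ≥ 6 ≥ 5` variables)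
  obtain ⟨x, hx0, hx⟩ :=
    diagIsotropic_of_five_le_of_indefinite (maximalRealSubfield L) (by omega) c hc0 hsgn
  have hXfix : ∀ i, IsCMField.complexConj L (x i) = x i := fun i => hfix (x i)
  rw [Fin.sum_univ_add] at hx
  simp only [hcl, hcr] at hx
  have h := congrArg Subtype.val hx
  push_cast at h
  have eA : ∀ i, ((A i : maximalRealSubfield L) : L) = a i := fun i => rfl
  have eD : ((D : maximalRealSubfield L) : L) = θ ^ 2 := rfl
  simp only [eA, eD] at h
  -- `vᵢ = xᵢ + yᵢ θ`
  refine ⟨fun i => (x (Fin.castAdd n i) : L) + (x (Fin.natAdd n i) : L) * θ, ?_, ?_⟩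
  · intro hv
    apply hx0
    funext k
    induction k using Fin.addCases with
    | left i =>
      have hk := eq_zero_of_add_mul_skew hθ0 hθ (hXfix _) (hXfix _) (congrFun hv i)
      exact Subtype.ext hk.1
    | right i =>
      have hk := eq_zero_of_add_mul_skew hθ0 hθ (hXfix _) (hXfix _) (congrFun hv i)
      exact Subtype.ext hk.2
  · have hσv : ∀ i, IsCMField.complexConj L ((x (Fin.castAdd n i) : L) + (x (Fin.natAdd n i) : L) * θ) =
        (x (Fin.castAdd n i) : L) - (x (Fin.natAdd n i) : L) * θ := fun i => by
      rw [map_add, map_mul, hXfix, hXfix, hθ]; ring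
    rw [← h, ← Finset.sum_add_distrib]
    exact Finset.sum_congr rfl fun i _ => by rw [hσv]; ring

variable {ι : Type} [Fintype ι] [DecidableEq ι]

/-- **Landherr's isotropy criterion** [La36] (via Jacobson's trace form and Hasse–Minkowski over `L⁺`,
O'Meara 66:1): a non-degenerate diagonal hermitian form `⟨a₁, …, aₙ⟩`, `aᵢ ∈ L⁺ˣ`, of rank `n ≥ 3` over the
CM field `L` has a non-zero isotropic vector iff at every complex embedding `τ` of `L` some `τ(aᵢ)` is negative
and some `τ(aⱼ)` is positive (the form is indefinite at every real place of `L⁺`).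
[cite: Landherr1936HermitianForms] -/
theorem hermitianDiagonal_isotropic_iff_indefinite (a : ι → L)
    (ha : ∀ i, IsCMField.complexConj L (a i) = a i) (ha0 : ∀ i, a i ≠ 0) (h3 : 3 ≤ Fintype.card ι) :
    (∃ v : ι → L, v ≠ 0 ∧ ∑ i, a i * (v i * IsCMField.complexConj L (v i)) = 0) ↔
      ∀ τ : L →+* ℂ, ∃ i j, (τ (a i)).re < 0 ∧ 0 < (τ (a j)).re := by
  constructor
  · intro hiso τ
    have hne : ∀ i, (τ (a i)).re ≠ 0 := fun i => re_ne_zero_of_isReal (ha i) (ha0 i) τ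
    by_cases hneg : ∃ i, (τ (a i)).re < 0
    · obtain ⟨i, hi⟩ := hneg
      by_cases hpos : ∃ j, 0 < (τ (a j)).re
      · obtain ⟨j, hj⟩ := hpos
        exact ⟨i, j, hi, hj⟩
      · exact absurd hiso (not_exists_isotropic_of_forall_neg L ha τ fun j =>
          lt_of_le_of_ne (not_lt.mp fun h => hpos ⟨j, h⟩) (hne j))
    · exact absurd hiso (not_exists_isotropic_of_forall_pos L ha τ fun i =>
        lt_of_le_of_ne (not_lt.mp fun h => hneg ⟨i, h⟩) (hne i).symm)
  · intro hind
    set e := Fintype.equivFin ι with he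
    have key := exists_isotropic_of_indefinite_fin L (n := Fintype.card ι) h3 (a ∘ e.symm)
      (fun i => ha _) (fun i => ha0 _) (fun τ => by
        obtain ⟨i, j, hi, hj⟩ := hind τ
        exact ⟨e i, e j, by simpa using hi, by simpa using hj⟩)
    have key' : ∃ v : ι → L, v ≠ 0 ∧
        ∑ i, (a ∘ e.symm) (e i) * (v i * IsCMField.complexConj L (v i)) = 0 :=
      (exists_isotropic_comp_equiv_iff L e (a ∘ e.symm)).mpr key
    simpa using key'

/-- The same with the positive index: `⟨a⟩` (rank `n ≥ 3`) is isotropic iff `0 < posCount L τ a < n` at every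
complex embedding `τ`. [cite: Landherr1936HermitianForms] -/
theorem hermitianDiagonal_isotropic_iff_posCount (a : ι → L)
    (ha : ∀ i, IsCMField.complexConj L (a i) = a i) (ha0 : ∀ i, a i ≠ 0) (h3 : 3 ≤ Fintype.card ι) :
    (∃ v : ι → L, v ≠ 0 ∧ ∑ i, a i * (v i * IsCMField.complexConj L (v i)) = 0) ↔
      ∀ τ : L →+* ℂ, 0 < posCount L τ a ∧ posCount L τ a < Fintype.card ι := by
  rw [hermitianDiagonal_isotropic_iff_indefinite L a ha ha0 h3]
  exact forall_congr' fun τ => exists_neg_pos_iff_posCount L ha ha0 τ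

end Indefinite

end Landherr

/-! ## The theorem for Gram matrices -/

open Landherr in
/-- **Landherr's isotropy criterion for hermitian matrices over a CM field** [La36].  Let `L` be a CM field with
complex conjugation `σ`, `H` a `σ`-hermitian matrix (`ᵗ(σH) = H`) of finite size `n ≥ 3` over `L` with
`det H ≠ 0`.  Then the hermitian form `⟪u, v⟫_H = ᵗ(σu) H v` (`hermForm σ H`) has a non-zero isotropic vector
iff at every complex embedding `τ` of `L` the complex hermitian matrix `τ(H)` has some, but not all, of its `n`
eigenvalues positive — i.e. `H` is indefinite at every real place of `L⁺`.  Proof: diagonalise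
(`hermitianMatrix_congruent_diagonal`), `hermitianDiagonal_isotropic_iff_posCount`, and Sylvester's law
`card_pos_eigenvalues_eq_posCount`. [cite: Landherr1936HermitianForms] -/
theorem hermitianMatrix_isotropic_iff_indefinite (L : Type) [Field L] [NumberField L] [IsCMField L]
    {ι : Type} [Fintype ι] [DecidableEq ι] (H : Matrix ι ι L)
    (hH : H.transpose.map (IsCMField.complexConj L) = H) (h0 : H.det ≠ 0) (h3 : 3 ≤ Fintype.card ι) :
    (∃ v : ι → L, v ≠ 0 ∧ hermForm (IsCMField.complexConj L : L →+* L) H v v = 0) ↔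
      ∀ τ : L →+* ℂ,
        0 < (Finset.univ.filter fun i => 0 < (isHermitian_map L hH τ).eigenvalues i).card ∧
          (Finset.univ.filter fun i => 0 < (isHermitian_map L hH τ).eigenvalues i).card < Fintype.card ι := by
  obtain ⟨g, d, hd, hd0, e⟩ := hermitianMatrix_congruent_diagonal L H hH h0
  have hG : IsUnit (g : Matrix ι ι L).det := Matrix.isUnits_det_units g
  have e' : ((g : Matrix ι ι L).map (IsCMField.complexConj L : L →+* L))ᵀ * H * (g : Matrix ι ι L) =
      Matrix.diagonal d := e
  have key : (∃ v : ι → L, v ≠ 0 ∧ hermForm (IsCMField.complexConj L : L →+* L) H v v = 0) ↔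
      ∃ w : ι → L, w ≠ 0 ∧ ∑ i, d i * (w i * IsCMField.complexConj L (w i)) = 0 := by
    constructor
    · rintro ⟨v, hv, h⟩
      obtain ⟨w, hw⟩ : ∃ w : ι → L, w = ((g⁻¹ : GL ι L) : Matrix ι ι L) *ᵥ v := ⟨_, rfl⟩
      have hvw : v = (g : Matrix ι ι L) *ᵥ w := by
        rw [hw, Matrix.mulVec_mulVec, ← Units.val_mul, mul_inv_cancel, Units.val_one, Matrix.one_mulVec]
      refine ⟨w, fun h0w => hv (by rw [hvw, h0w, Matrix.mulVec_zero]), ?_⟩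
      rw [hvw, hermForm_mulVec_mulVec, e', hermForm_complexConj_diagonal_self] at h
      exact h
    · rintro ⟨w, hw, h⟩
      refine ⟨(g : Matrix ι ι L) *ᵥ w, mulVec_ne_zero g hw, ?_⟩
      rw [hermForm_mulVec_mulVec, e', hermForm_complexConj_diagonal_self]
      exact h
  rw [key, hermitianDiagonal_isotropic_iff_posCount L d hd hd0 h3]
  refine forall_congr' fun τ => ?_
  rw [card_pos_eigenvalues_eq_posCount L hH hG e τ]

end Literature.NumberTheory.QuadraticForms

end
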